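import Mathlib.Algebra.Order.Antidiag.FinsuppEquiv
import Mathlib.Tactic.Abel
import Mathlib.RingTheory.MvPolynomial.MonomialOrder
import Mathlib.RingTheory.MvPolynomial.Homogeneous
import Mathlib.LinearAlgebra.Dimension.Finite
import Mathlib.LinearAlgebra.Dimension.StrongRankCondition
import Mathlib.LinearAlgebra.Dimension.Constructions
import Mathlib.LinearAlgebra.FiniteDimensional.Defs
import Mathlib.RingTheory.Noetherian.Basic
import Literature.RingTheory.MvPolynomial.MacaulayCompression
import Literature.RingTheory.MvPolynomial.MacaulayBound
import HarnessLib

/-!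
# Macaulay's growth bound — discharge of the named fact `MacaulayGrowthBound`

`theorem MacaulayGrowthBound_holds : MacaulayGrowthBound`, the fact vendored in `MacaulayBound.lean`
(Efremenko–Landsberg–Schenck–Weyman 2018, Cor. 2.4, an instance of Macaulay's theorem): if a space
`V` of forms of degree `d` in `N` variables over a field `K` has `dim V ≥ dim S^m = binom(N+m-1, m)`
(`m = d - q ≤ d`), then `dim S^τ·V ≥ dim S^{m+τ} = binom(N+m+τ-1, m+τ)` for every `τ`. Any field.

Proof. (1) `Macaulay.choose_le_card_image_add`: the lex segment at the threshold is
`x_0^{d-m}·Mon_m ⊆ Mon_d` (`Macaulay.special`), of size `|Mon_m|`, and its shadow contains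
`x_0^{d-m}·Mon_{m+1}`; so by Macaulay's theorem (`Macaulay.card_shadow_le_of_isLexSeg`, Part II)
every `A ⊆ Mon_d` with `|A| ≥ |Mon_m|` has `|∇A| ≥ |Mon_{m+1}|`, and inductively
`|{x^β a : |β| = τ, a ∈ A}| = |∇^τ A| ≥ |Mon_{m+τ}|`. (2) Leading monomials for the lex monomial
order (after choosing a linear order on the variable type): `dim V ≤ #D`, `D` the set of leading
monomials of `V ∖ 0` (`finrank_le_card_of_degree_mem`: the coefficient map `v ↦ (coeff_δ v)_{δ ∈ D}`
is injective on `V`), and `#{β + δ : |β| = τ, δ ∈ D} ≤ dim S^τ·V` (`card_le_finrank_of_degree`: the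
products `x^β v_δ` realise these exponents as pairwise distinct leading monomials, hence are linearly
independent; `S^τ·V` lies in the finite-dimensional homogeneous component of degree `d + τ`).
ELSW derive Cor. 2.4 from Macaulay's bound in Green's codimension form by a binomial identity; the
route here needs no Macaulay representations.

## References

* [EfremenkoLandsbergSchenckWeyman2018] K. Efremenko, J. M. Landsberg, H. Schenck, J. Weyman,
  *The method of shifted partial derivatives cannot separate the permanent from the determinant*,
  Math. Comp. 87 (2018), Thm. 2.1 and Cor. 2.4.
* [MillerSturmfels2005] E. Miller, B. Sturmfels, *Combinatorial Commutative Algebra*, §2.4, Thm. 2.22.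
* [BrunsHerzog1998] W. Bruns, J. Herzog, *Cohen–Macaulay rings*, Thm. 4.2.10 (Macaulay).
-/

namespace Literature.RingTheory.MvPolynomial.Macaulay

open Finset

variable {n : ℕ}

/-! ## The lex segment `x_0^{d-m} · Mon_m` and the growth bound at the thresholds `|Mon_m|` -/

section Special

variable {N : ℕ}

/-- Degree of a multiple of a unit vector. [folklore] -/
theorem sum_smul_e (t : ℕ) (i : Fin N) : ∑ l, (t • e i) l = t := by
  have : ∑ l, (t • e i) l = ∑ l, t * e i l := by simp
  rw [this, ← mul_sum, sum_e, mul_one]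

/-- Multiplying by `x_i^t` raises the degree by `t`. [folklore] -/
theorem sum_add_smul_e (a : Fin N → ℕ) (t : ℕ) (i : Fin N) : ∑ l, (a + t • e i) l = (∑ l, a l) + t := by
  have : ∑ l, (a + t • e i) l = ∑ l, a l + ∑ l, (t • e i) l := by
    rw [← sum_add_distrib]; rfl
  rw [this, sum_smul_e]

/-- `t • e i ≤ a` coordinatewise iff `x_i^t ∣ a`. [folklore] -/
theorem smul_e_le_iff {a : Fin N → ℕ} {t : ℕ} {i : Fin N} : t • e i ≤ a ↔ t ≤ a i := by
  constructor
  · intro h; simpa [smul_e_apply] using h i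
  · intro h l
    simp only [smul_e_apply]
    split_ifs with hl
    · subst hl; exact h
    · exact Nat.zero_le _

/-- Dividing by `x_i^t` lowers the degree by `t`. [folklore] -/
theorem sum_sub_smul_e {a : Fin N → ℕ} {t : ℕ} {i : Fin N} (h : t ≤ a i) :
    ∑ l, (a - t • e i) l = (∑ l, a l) - t := by
  have : ∑ l, (a - t • e i) l = ∑ l, (a l - (t • e i) l) := by simp
  rw [this, sum_tsub_distrib _ (fun l _ => (smul_e_le_iff.2 h) l), sum_smul_e]

/-- The number of monomials of degree `m` in `N` variables is `binom(N + m - 1, m)`. [folklore] -/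
theorem card_Mon (N m : ℕ) : (Mon N m).card = (N + m - 1).choose m := by
  classical
  have h : Mon N m = ((univ : Finset (Fin N)).finsuppAntidiag m).map
      Finsupp.equivFunOnFinite.toEmbedding := by
    ext u
    simp only [mem_map_equiv, mem_finsuppAntidiag, mem_Mon]
    constructor
    · intro hu
      exact ⟨by simpa [Finsupp.equivFunOnFinite] using hu, subset_univ _⟩
    · rintro ⟨hu, -⟩
      simpa [Finsupp.equivFunOnFinite] using hu
  rw [h, card_map, card_finsuppAntidiag_nat_eq_choose, card_univ, Fintype.card_fin]

/-- `T d m = x_z^{d-m} · Mon_m` (`z` the first variable): the monomials of degree `d` whose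
`x_z`-exponent is at least `d - m`.
[folklore] -/
def special (z : Fin N) (d m : ℕ) : Finset (Fin N → ℕ) := (Mon N d).filter fun u => d - m ≤ u z

/-- `x_0^{d-m} Mon_m` is a lex segment (`x_0` is the most significant variable). [folklore] -/
theorem isLexSeg_special (hN : 0 < N) (d m : ℕ) : IsLexSeg (special ⟨0, hN⟩ d m) d := by
  refine ⟨filter_subset _ _, fun u hu v hv hlt => ?_⟩
  rw [special, mem_filter] at hu ⊢
  refine ⟨hv, ?_⟩
  obtain ⟨p, hp, hup⟩ := lex_lt_iff.1 hlt
  by_cases hp0 : p = ⟨0, hN⟩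
  · subst hp0; exact hu.2.trans hup.le
  · have := hp ⟨0, hN⟩ (lt_of_le_of_ne (Fin.le_def.2 (Nat.zero_le _)) (Ne.symm hp0))
    rw [← this]; exact hu.2

/-- `|x_z^{d-m} Mon_m| = |Mon_m|`. [folklore] -/
theorem card_special (z : Fin N) {d m : ℕ} (hm : m ≤ d) : (special z d m).card = (Mon N m).card := by
  have h : special z d m = (Mon N m).image fun v => v + (d - m) • e z := by
    ext u
    simp only [special, mem_filter, mem_image, mem_Mon]
    constructor
    · rintro ⟨hu, hz⟩
      refine ⟨u - (d - m) • e z, ?_, ?_⟩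
      · rw [sum_sub_smul_e hz, hu]; omega
      · ext l
        simp only [Pi.add_apply, Pi.sub_apply, smul_e_apply]
        split_ifs with hl
        · subst hl; omega
        · simp
    · rintro ⟨v, hv, rfl⟩
      refine ⟨?_, by simp⟩
      rw [sum_add_smul_e, hv]; omega
  rw [h, card_image_of_injective _ (add_left_injective _)]

/-- `x_0^{d-m} Mon_{m+1} ⊆ ∇(x_0^{d-m} Mon_m)`. [folklore] -/
theorem special_succ_subset_shadow (hN : 0 < N) (d m : ℕ) :
    special ⟨0, hN⟩ (d + 1) (m + 1) ⊆ shadow (special ⟨0, hN⟩ d m) := by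
  intro v hv
  rw [special, mem_filter] at hv
  obtain ⟨hv, hvz⟩ := hv
  obtain ⟨l, hl, hlmax⟩ := exists_last_var hv
  have hu : v - e l ∈ special ⟨0, hN⟩ d m := by
    rw [special, mem_filter]
    refine ⟨sub_e_mem_Mon hv hl, ?_⟩
    simp only [Pi.sub_apply, e_apply]
    split_ifs with hzl
    · -- `l` is the first variable: then `v` is a pure power of it
      subst hzl
      have hsum := mem_Mon.1 hv
      have : ∑ r, v r = v ⟨0, hN⟩ := by
        rw [← Finset.sum_erase_add _ _ (mem_univ (⟨0, hN⟩ : Fin N)), Finset.sum_eq_zero]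
        · simp
        · intro r hr
          rw [mem_erase] at hr
          exact hlmax r (Fin.lt_def.2 (Nat.pos_of_ne_zero fun h0 => hr.1 (Fin.ext h0)))
      omega
    · omega
  rw [← sub_e_add_e hl]
  exact add_e_mem_shadow hu l

/-- **Growth at the thresholds.** If `A ⊆ Mon_d` has at least `|Mon_m|` elements (`m ≤ d`), its
upper shadow has at least `|Mon_{m+1}|` elements (Macaulay's theorem at the lex segment
`x_0^{d-m} Mon_m`, whose shadow is `x_0^{d-m} Mon_{m+1}`).
[cite: EfremenkoLandsbergSchenckWeyman2018, Cor. 2.4 (τ = 1)] -/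
theorem card_Mon_succ_le_card_shadow (hN : 0 < N) {d m : ℕ} (hm : m ≤ d) {A : Finset (Fin N → ℕ)}
    (hA : A ⊆ Mon N d) (hcard : (Mon N m).card ≤ A.card) :
    (Mon N (m + 1)).card ≤ (shadow A).card := by
  set z : Fin N := ⟨0, hN⟩
  calc (Mon N (m + 1)).card = (special z (d + 1) (m + 1)).card := (card_special z (by omega)).symm
    _ ≤ (shadow (special z d m)).card := card_le_card (special_succ_subset_shadow hN d m)
    _ ≤ (shadow A).card :=
        card_shadow_le_of_isLexSeg (isLexSeg_special hN d m) hA (by rwa [card_special z hm])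

/-- Iterating: `|∇^τ A| ≥ |Mon_{m+τ}|`. [cite: EfremenkoLandsbergSchenckWeyman2018, Cor. 2.4] -/
theorem card_Mon_add_le_card_iterate_shadow (hN : 0 < N) (τ : ℕ) :
    ∀ {d m : ℕ} {A : Finset (Fin N → ℕ)}, m ≤ d → A ⊆ Mon N d → (Mon N m).card ≤ A.card →
      (Mon N (m + τ)).card ≤ (shadow^[τ] A).card := by
  induction τ with
  | zero => intro d m A _ _ h; simpa using h
  | succ τ ih =>
    intro d m A hm hA h
    rw [Function.iterate_succ_apply, show m + (τ + 1) = m + 1 + τ by omega]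
    exact ih (by omega) (shadow_subset_Mon hA) (card_Mon_succ_le_card_shadow hN hm hA h)

/-- The `τ`-fold shadow consists of the products `x^β · a`, `|β| = τ`, `a ∈ A`. [folklore] -/
theorem iterate_shadow_subset (τ : ℕ) (A : Finset (Fin N → ℕ)) :
    shadow^[τ] A ⊆ (Mon N τ ×ˢ A).image fun p => p.1 + p.2 := by
  induction τ with
  | zero =>
    intro a ha
    exact mem_image.2 ⟨(0, a), mem_product.2 ⟨by simp [mem_Mon], ha⟩, by simp⟩
  | succ τ ih =>
    intro b hb
    rw [Function.iterate_succ_apply'] at hb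
    obtain ⟨c, hc, l, rfl⟩ := mem_shadow.1 hb
    obtain ⟨p, hp, rfl⟩ := mem_image.1 (ih hc)
    rw [mem_product] at hp
    refine mem_image.2 ⟨(p.1 + e l, p.2), mem_product.2 ⟨add_e_mem_Mon hp.1 l, hp.2⟩, ?_⟩
    simp only
    abel

/-- **Macaulay's growth bound, combinatorial form.** For `A ⊆ Mon_d` with `|A| ≥ binom(N+m-1, m)`,
`m ≤ d`, the set of products `{x^β a : |β| = τ, a ∈ A}` has at least `binom(N+m+τ-1, m+τ)` elements.
[cite: EfremenkoLandsbergSchenckWeyman2018, Cor. 2.4] -/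
theorem choose_le_card_image_add (hN : 0 < N) {d m : ℕ} (hm : m ≤ d) (τ : ℕ) {A : Finset (Fin N → ℕ)}
    (hA : A ⊆ Mon N d) (hcard : (N + m - 1).choose m ≤ A.card) :
    (N + (m + τ) - 1).choose (m + τ) ≤ ((Mon N τ ×ˢ A).image fun p => p.1 + p.2).card := by
  rw [← card_Mon] at hcard ⊢
  exact (card_Mon_add_le_card_iterate_shadow hN τ hm hA hcard).trans
    (card_le_card (iterate_shadow_subset τ A))

end Special

end Literature.RingTheory.MvPolynomial.Macaulay

/-! ## From subspaces of forms to monomial families (leading monomials), and the discharge -/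

namespace Literature.RingTheory.MvPolynomial

open _root_.MvPolynomial Finset

section LinearAlgebra

variable {K : Type*} [Field K] {σ : Type*} (mo : MonomialOrder σ)

/-- `dim V ≤ #D` whenever every nonzero member of `V` has its leading monomial in `D`: the coefficient
map `v ↦ (coeff_δ v)_{δ ∈ D}` is injective on `V`. [folklore] -/
theorem finrank_le_card_of_degree_mem {V : Submodule K (MvPolynomial σ K)} {D : Finset (σ →₀ ℕ)}
    (hD : ∀ v ∈ V, v ≠ 0 → mo.degree v ∈ D) : Module.finrank K V ≤ D.card := by
  classical
  let φ : V →ₗ[K] (D → K) :=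
    { toFun := fun v δ => (v : MvPolynomial σ K).coeff δ.1
      map_add' := fun v w => by ext δ; simp
      map_smul' := fun c v => by ext δ; simp [MvPolynomial.coeff_smul] }
  have hinj : Function.Injective φ := by
    rw [injective_iff_map_eq_zero]
    intro v hv
    by_contra hv0
    have hv0' : (v : MvPolynomial σ K) ≠ 0 := fun h => hv0 (Subtype.ext h)
    have hmem := hD v v.2 hv0'
    have h1 : (v : MvPolynomial σ K).coeff (mo.degree (v : MvPolynomial σ K)) = 0 :=
      congrFun hv ⟨_, hmem⟩
    exact mo.coeff_degree_ne_zero_iff.2 hv0' h1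
  have h := LinearMap.finrank_le_finrank_of_injective hinj
  rwa [Module.finrank_fintype_fun_eq_card, Fintype.card_coe] at h

/-- Polynomials with pairwise distinct leading monomials are linearly independent. [folklore] -/
theorem linearIndependent_of_degree_eq {E : Finset (σ →₀ ℕ)} {p : (σ →₀ ℕ) → MvPolynomial σ K}
    (hp0 : ∀ μ ∈ E, p μ ≠ 0) (hdeg : ∀ μ ∈ E, mo.degree (p μ) = μ) :
    LinearIndependent K (fun μ : E => p μ) := by
  classical
  rw [Fintype.linearIndependent_iff]
  intro g hg
  by_contra hne
  push Not at hne
  obtain ⟨μ₁, hμ₁⟩ := hne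
  obtain ⟨μ₀, hμ₀mem, hmax⟩ := exists_max_image (univ.filter fun μ : E => g μ ≠ 0)
    (fun μ => mo.toSyn μ.1) ⟨μ₁, mem_filter.2 ⟨mem_univ _, hμ₁⟩⟩
  rw [mem_filter] at hμ₀mem
  have hcoeff := congrArg (MvPolynomial.coeff μ₀.1) hg
  rw [MvPolynomial.coeff_sum, MvPolynomial.coeff_zero, Finset.sum_eq_single μ₀] at hcoeff
  · rw [MvPolynomial.coeff_smul, smul_eq_mul] at hcoeff
    have hlc : (p μ₀.1).coeff μ₀.1 ≠ 0 := by
      have := mo.coeff_degree_ne_zero_iff.2 (hp0 _ μ₀.2)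
      rwa [hdeg _ μ₀.2] at this
    exact hμ₀mem.2 ((mul_eq_zero.1 hcoeff).resolve_right hlc)
  · intro μ _ hμne
    by_cases hgμ : g μ = 0
    · simp [hgμ]
    · have hle := hmax μ (mem_filter.2 ⟨mem_univ _, hgμ⟩)
      have hlt : mo.toSyn μ.1 < mo.toSyn μ₀.1 :=
        lt_of_le_of_ne hle fun h => hμne (Subtype.ext (mo.toSyn.injective h))
      rw [MvPolynomial.coeff_smul, mo.coeff_eq_zero_of_lt (by rwa [hdeg _ μ.2]), smul_zero]
  · intro h; exact absurd (mem_univ _) h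

/-- `#E ≤ dim W` if every `μ ∈ E` is the leading monomial of some nonzero member of `W`. [folklore] -/
theorem card_le_finrank_of_degree {W : Submodule K (MvPolynomial σ K)} [Module.Finite K W]
    {E : Finset (σ →₀ ℕ)} (h : ∀ μ ∈ E, ∃ p ∈ W, p ≠ 0 ∧ mo.degree p = μ) :
    E.card ≤ Module.finrank K W := by
  classical
  choose! p hpW hp0 hpdeg using h
  have hli : LinearIndependent K (fun μ : E => p μ) := linearIndependent_of_degree_eq mo hp0 hpdeg
  have hli' : LinearIndependent K (fun μ : E => (⟨p μ, hpW μ μ.2⟩ : W)) :=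
    LinearIndependent.of_comp W.subtype hli
  simpa using hli'.fintype_card_le_finrank

end LinearAlgebra

section Transport

variable {σ : Type*} [Fintype σ]

/-- Membership in `univ.finsuppAntidiag n` is having degree `n`. [folklore] -/
theorem mem_finsuppAntidiag_univ_iff [DecidableEq σ] {f : σ →₀ ℕ} {n : ℕ} :
    f ∈ (univ : Finset σ).finsuppAntidiag n ↔ f.degree = n := by
  simp [mem_finsuppAntidiag, Finsupp.degree_eq_sum]

/-- Transport of the combinatorial bound to exponent vectors `σ →₀ ℕ` on an arbitrary finite `σ`. [cite: EfremenkoLandsbergSchenckWeyman2018, Cor. 2.4] -/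
theorem choose_le_card_image_add_finsupp [DecidableEq σ] (hN : 0 < Fintype.card σ) {d m : ℕ}
    (hm : m ≤ d) (τ : ℕ) {D : Finset (σ →₀ ℕ)} (hD : ∀ δ ∈ D, δ.degree = d)
    (hcard : (Fintype.card σ + m - 1).choose m ≤ D.card) :
    (Fintype.card σ + (m + τ) - 1).choose (m + τ) ≤
      ((((univ : Finset σ).finsuppAntidiag τ) ×ˢ D).image fun p => p.1 + p.2).card := by
  classical
  set N := Fintype.card σ
  set eqv := Fintype.equivFin σ
  -- the transport map
  let Φ : (σ →₀ ℕ) → (Fin N → ℕ) := fun f k => f (eqv.symm k)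
  have hΦinj : Function.Injective Φ := by
    intro f g h
    ext s
    have := congrFun h (eqv s)
    simpa [Φ] using this
  have hΦsum : ∀ f : σ →₀ ℕ, ∑ k, Φ f k = f.degree := fun f => by
    rw [Finsupp.degree_eq_sum]
    exact Equiv.sum_comp eqv.symm (fun s => f s)
  have hΦadd : ∀ f g : σ →₀ ℕ, Φ (f + g) = Φ f + Φ g := fun f g => by
    funext k; simp [Φ]
  -- the transported family
  set A := D.image Φ with hA
  have hAMon : A ⊆ Macaulay.Mon N d := by
    intro u hu
    obtain ⟨δ, hδ, rfl⟩ := mem_image.1 hu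
    rw [Macaulay.mem_Mon, hΦsum, hD δ hδ]
  have hcardA : (N + m - 1).choose m ≤ A.card := by
    rwa [hA, card_image_of_injective _ hΦinj]
  refine (Macaulay.choose_le_card_image_add hN hm τ hAMon hcardA).trans ?_
  refine le_trans (card_le_card ?_) (card_image_le (f := Φ))
  intro w hw
  obtain ⟨⟨u, a⟩, hua, rfl⟩ := mem_image.1 hw
  rw [mem_product] at hua
  obtain ⟨hu, ha⟩ := hua
  obtain ⟨δ, hδ, rfl⟩ := mem_image.1 ha
  -- `u = Φ β` for the pulled-back exponent vector `β`
  set β : σ →₀ ℕ := Finsupp.equivFunOnFinite.symm fun s => u (eqv s) with hβ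
  have hΦβ : Φ β = u := by funext k; simp [Φ, hβ]
  have hβdeg : β.degree = τ := by rw [← hΦsum, hΦβ]; exact Macaulay.mem_Mon.1 hu
  refine mem_image.2 ⟨β + δ, mem_image.2 ⟨(β, δ), mem_product.2
    ⟨mem_finsuppAntidiag_univ_iff.2 hβdeg, hδ⟩, rfl⟩, ?_⟩
  simp only [hΦadd, hΦβ]

end Transport

/-- **Discharge of the named fact `MacaulayGrowthBound`** (Efremenko–Landsberg–Schenck–Weyman 2018,
Cor. 2.4 = Macaulay's theorem at the lex segment `x_0^{q} S^{d-q}`): proved from the combinatorial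
Macaulay theorem `Macaulay.card_shadow_le_of_isLexSeg` (Miller–Sturmfels Thm. 2.22 with a
compression argument replacing generic initial ideals) by passing to lex-leading monomials.
[cite: EfremenkoLandsbergSchenckWeyman2018, Cor. 2.4] [cite: MillerSturmfels2005, Thm. 2.22 and Lemma 2.25] -/
theorem MacaulayGrowthBound_holds : MacaulayGrowthBound := by
  intro K _ σ _ d q τ V hqd hV hdim
  classical
  rcases Nat.eq_zero_or_pos (Fintype.card σ) with hN | hN
  · rw [hN, Nat.choose_eq_zero_of_lt (by omega)]; exact Nat.zero_le _
  set m := d - q with hmdef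
  have hm : m ≤ d := Nat.sub_le d q
  -- a linear order on `σ` and the lex monomial order
  letI : LinearOrder σ := LinearOrder.lift' (Fintype.equivFin σ) (Fintype.equivFin σ).injective
  let mo : MonomialOrder σ := MonomialOrder.lex
  -- leading monomials of members of `V`
  have hdegV : ∀ v ∈ V, v ≠ 0 → (mo.degree v).degree = d := by
    intro v hv hv0
    have h1 := mo.coeff_degree_ne_zero_iff.2 hv0
    have h2 := hV v hv h1
    have h3 : (Finsupp.weight fun _ : σ => (1 : ℕ)) (mo.degree v) = d := h2
    rwa [← Finsupp.degree_eq_weight_one] at h3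
  set D : Finset (σ →₀ ℕ) :=
    ((univ : Finset σ).finsuppAntidiag d).filter fun δ => ∃ v ∈ V, v ≠ 0 ∧ mo.degree v = δ with hDdef
  have hDmem : ∀ v ∈ V, v ≠ 0 → mo.degree v ∈ D := fun v hv hv0 =>
    mem_filter.2 ⟨mem_finsuppAntidiag_univ_iff.2 (hdegV v hv hv0), v, hv, hv0, rfl⟩
  have hDdeg : ∀ δ ∈ D, δ.degree = d := fun δ hδ =>
    mem_finsuppAntidiag_univ_iff.1 (mem_filter.1 hδ).1
  have hcardD : (Fintype.card σ + m - 1).choose m ≤ D.card :=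
    hdim.trans (finrank_le_card_of_degree_mem mo hDmem)
  -- the degree-`(d+τ)` part of the ideal `(V)` is finite-dimensional
  set W : Submodule K (MvPolynomial σ K) := Submodule.span K
    {p : MvPolynomial σ K | ∃ (β : σ →₀ ℕ) (v : MvPolynomial σ K),
      β.degree = τ ∧ v ∈ V ∧ p = monomial β 1 * v} with hWdef
  have hWle : W ≤ homogeneousSubmodule σ K (τ + d) := by
    rw [hWdef, Submodule.span_le]
    rintro p ⟨β, v, hβ, hv, rfl⟩
    exact (mem_homogeneousSubmodule _ _).2 ((isHomogeneous_monomial (1 : K) hβ).mul (hV v hv))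
  haveI : Module.Finite K (homogeneousSubmodule σ K (τ + d)) :=
    Module.Finite.iff_fg.2 (homogeneousSubmodule_fg σ K (τ + d))
  haveI : Module.Finite K W :=
    Module.Finite.of_injective (Submodule.inclusion hWle) (Submodule.inclusion_injective hWle)
  -- every `x^β · δ`, `δ` a leading monomial of `V`, is a leading monomial of `W`
  set E : Finset (σ →₀ ℕ) :=
    ((((univ : Finset σ).finsuppAntidiag τ) ×ˢ D).image fun p => p.1 + p.2) with hEdef
  have hE : ∀ μ ∈ E, ∃ p ∈ W, p ≠ 0 ∧ mo.degree p = μ := by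
    intro μ hμ
    obtain ⟨⟨β, δ⟩, hβδ, rfl⟩ := mem_image.1 hμ
    rw [mem_product] at hβδ
    obtain ⟨hβ, hδ⟩ := hβδ
    obtain ⟨-, v, hv, hv0, hvdeg⟩ := mem_filter.1 hδ
    have hmon0 : (monomial β (1 : K)) ≠ 0 := monomial_eq_zero.not.2 one_ne_zero
    refine ⟨monomial β 1 * v, Submodule.subset_span ⟨β, v, mem_finsuppAntidiag_univ_iff.1 hβ, hv, rfl⟩,
      mul_ne_zero hmon0 hv0, ?_⟩
    rw [mo.degree_mul hmon0 hv0, mo.degree_monomial, if_neg one_ne_zero, hvdeg]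
  have hcardE : E.card ≤ Module.finrank K W := card_le_finrank_of_degree mo hE
  exact (choose_le_card_image_add_finsupp hN hm τ hDdeg hcardD).trans hcardE

end Literature.RingTheory.MvPolynomial
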